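import Mathlib.AlgebraicGeometry.EllipticCurve.Affine.Point
import Mathlib.Data.ZMod.ValMinAbs
import HarnessLib

/-!
# The special fibres `y² = x³ − x + b̄` over `𝔽₃` of the principal-series rows: point counts and the
# Frobenius trace `a = −3·b̄` (route `CyclotomicUntwist`, LAW L-a3; cruxes K1 `PSRankOneLowerHalfAtThree` / K2)

Cell `pub/bsd-wall` (D-0145 line `route-BirchSwinnertonDyer-CyclotomicUntwist`), seat `bsd-line-cycu-p3` (gen 6).
Helper toward K1 (stmt-BirchSwinnertonDyer-21580) / K2 (stmt-21581). THEOREMS ONLY (no definition, no named fact,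
no `sorry`); BSD is not proved by this file and no crux is.

`CyclotomicUntwistGNineSpecialFibre` (cycu-p3 g5, p610052) proves that the good model over `ℚ(ζ₉)` of every curve of
the two wild principal-series leaf families reduces modulo the place `w ∣ 3` to `y² = x³ − x + b̄`
(`b̄ = γ̄₁` on leaf II, `−γ̄₁` on leaf IV); the residue field of `ℚ₃(ζ₉)` is `𝔽₃`. This file does the one
finite computation the memo `LAW-La3-KERNEL-v3.md` left informal — the POINT COUNT of these three curves over
`𝔽₃ = ZMod 3` and the resulting trace `a := 3 + 1 − #Ē(𝔽₃)`:

| `b̄` | affine solutions of `y² = x³ − x + b̄` | `#Ē(𝔽₃)` | `a = 4 − #Ē(𝔽₃)` |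
|---|---|---|---|
| `0` | `(0,0), (1,0), (2,0)` | `4` | `0` |
| `1` | `x³ − x + 1 = 1`, `y = ±1`: six | `7` | `−3` |
| `−1` | `y² = −1`: none | `1` | `+3` |

i.e. **`a = −3·b̄`** with `b̄` lifted to `{−1, 0, 1}` (`ZMod.valMinAbs`): the value table `{0, ±3}` of the untwisted
trace `a_w` of LAW L-a3 (the curves are supersingular, `j = 0`, `3 ∣ a`). Mathlib's `WeierstrassCurve.Affine.Point`
(with the point at infinity) is counted through `WeierstrassCurve.Affine.pointEquiv`.

* `specialFibre b` is local NOTATION-FREE shorthand in statements only: the curve `⟨0, 0, 0, −1, b⟩` over `ZMod 3`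
  is written out in each statement (no `def`).
* `isElliptic_specialFibre` — `Δ = 1` in `𝔽₃`; `card_affine_solutions` — `3 / 6 / 0` affine solutions;
  **`natCard_point_specialFibre`** — `#Ē(𝔽₃) = 4 + 3·valMinAbs b = 4 / 7 / 1`; **`trace_specialFibre : 4 − #Ē(𝔽₃) = −3·valMinAbs b`**;
  `trace_specialFibre_eq_zero_iff : a = 0 ↔ b = 0`.

References: J. Tate, LNM 476 (1975) §7 [Tate1975]; A. Kraus, Manuscripta Math. 69 (1990) [Kraus1990];
J. H. Silverman, *AEC*, V.2 (`a = q + 1 − #E(𝔽_q)`), Ex. V.4.4 (supersingular `j = 0` in characteristic `3`)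
[SilvermanAEC2009].
-/

set_option autoImplicit false
-- single-conjunct summit: `Summit.BirchSwinnertonDyer.BirchSwinnertonDyer.…` repeats the name by design
set_option linter.dupNamespace false

namespace Summit.BirchSwinnertonDyer.BirchSwinnertonDyer.Theorems.GNineSpecialFibrePointCount

open WeierstrassCurve

/-! ### The curves `y² = x³ − x + b` over `𝔽₃` are elliptic -/

/-- `Δ(y² = x³ − x + b) = 64 − 432b² = 1` in `𝔽₃`. [folklore] -/
theorem Δ_specialFibre (b : ZMod 3) : (⟨0, 0, 0, -1, b⟩ : WeierstrassCurve (ZMod 3)).Δ = 1 := by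
  simp only [WeierstrassCurve.Δ, WeierstrassCurve.b₂, WeierstrassCurve.b₄, WeierstrassCurve.b₆,
    WeierstrassCurve.b₈]
  have h432 : (432 : ZMod 3) = 0 := by decide
  have h64 : (64 : ZMod 3) = 1 := by decide
  linear_combination (-(b ^ 2)) * h432 + h64

/-- The special fibres are elliptic curves over `𝔽₃` (unit discriminant). [folklore] -/
theorem isElliptic_specialFibre (b : ZMod 3) : (⟨0, 0, 0, -1, b⟩ : WeierstrassCurve (ZMod 3)).IsElliptic :=
  ⟨by rw [Δ_specialFibre]; exact isUnit_one⟩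

/-! ### Affine solutions -/

/-- The three elements of `𝔽₃`. [folklore] -/
theorem zmod_three_cases (b : ZMod 3) : b = 0 ∨ b = 1 ∨ b = 2 := by
  decide +revert

/-- `valMinAbs` on `𝔽₃`: `0 ↦ 0`, `1 ↦ 1`, `2 ↦ −1`. [folklore] -/
theorem valMinAbs_three_values :
    ZMod.valMinAbs (0 : ZMod 3) = 0 ∧ ZMod.valMinAbs (1 : ZMod 3) = 1 ∧ ZMod.valMinAbs (2 : ZMod 3) = -1 := by
  decide


/-- The affine solution sets: `#{(x, y) ∈ 𝔽₃² : y² = x³ − x + b} = 3, 6, 0` for `b = 0, 1, −1`, written uniformly as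
`3 + 3·valMinAbs b` (`valMinAbs : 0, 1, 2 ↦ 0, 1, −1`). [cite: SilvermanAEC2009, V.2] -/
theorem card_affine_solutions (b : ZMod 3) :
    (Fintype.card {xy : ZMod 3 × ZMod 3 // xy.2 ^ 2 = xy.1 ^ 3 - xy.1 + b} : ℤ) = 3 + 3 * ZMod.valMinAbs b := by
  rcases zmod_three_cases b with rfl | rfl | rfl <;> decide

/-- The Mathlib equation predicate of `⟨0,0,0,−1,b⟩` is `y² = x³ − x + b`. [folklore] -/
theorem equation_specialFibre_iff (b x y : ZMod 3) :
    (⟨0, 0, 0, -1, b⟩ : WeierstrassCurve (ZMod 3)).toAffine.Equation x y ↔ y ^ 2 = x ^ 3 - x + b := by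
  rw [WeierstrassCurve.Affine.equation_iff]
  change y ^ 2 + 0 * x * y + 0 * y = x ^ 3 + 0 * x ^ 2 + (-1) * x + b ↔ _
  constructor <;> intro h <;> linear_combination h

/-! ### Point counts with the point at infinity, and the trace -/

/-- **`#Ē(𝔽₃) = 1 + #{affine solutions} = 4 + 3·valMinAbs b`** (`4, 7, 1` for `b = 0, 1, −1`), counting Mathlib's
`WeierstrassCurve.Affine.Point` (nonsingular affine points and `𝒪`) through `WeierstrassCurve.Affine.pointEquiv`.
[cite: SilvermanAEC2009, V.2] -/
theorem natCard_point_specialFibre (b : ZMod 3) :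
    (Nat.card (⟨0, 0, 0, -1, b⟩ : WeierstrassCurve (ZMod 3)).toAffine.Point : ℤ) = 4 + 3 * ZMod.valMinAbs b := by
  haveI := isElliptic_specialFibre b
  set W : WeierstrassCurve (ZMod 3) := ⟨0, 0, 0, -1, b⟩ with hW
  have e1 : W.toAffine.Point ≃ WithZero {xy : ZMod 3 × ZMod 3 // W.toAffine.Equation xy.1 xy.2} :=
    WeierstrassCurve.Affine.pointEquiv W.toAffine
  have e2 : {xy : ZMod 3 × ZMod 3 // W.toAffine.Equation xy.1 xy.2} ≃
      {xy : ZMod 3 × ZMod 3 // xy.2 ^ 2 = xy.1 ^ 3 - xy.1 + b} :=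
    Equiv.subtypeEquivRight fun xy ↦ equation_specialFibre_iff b xy.1 xy.2
  rw [Nat.card_congr (e1.trans (e2.optionCongr)), Nat.card_eq_fintype_card, Fintype.card_option]
  push_cast
  rw [card_affine_solutions b]
  ring

/-- **The Frobenius trace of the special fibre: `a := 3 + 1 − #Ē(𝔽₃) = −3·b̄`** (`b̄ = valMinAbs b ∈ {−1, 0, 1}`),
i.e. `a = 0, −3, +3` for `b = 0, 1, −1` — the value set `{0, ±3}` of LAW L-a3. [cite: SilvermanAEC2009, V.2]
[cite: Kraus1990, Théorème (p = 3)] -/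
theorem trace_specialFibre (b : ZMod 3) :
    (3 : ℤ) + 1 - Nat.card (⟨0, 0, 0, -1, b⟩ : WeierstrassCurve (ZMod 3)).toAffine.Point = -3 * ZMod.valMinAbs b := by
  rw [natCard_point_specialFibre b]
  ring

/-- The three values: `#Ē(𝔽₃) = 4, 7, 1` for `b = 0, 1, 2`. [cite: SilvermanAEC2009, V.2] -/
theorem natCard_point_specialFibre_values :
    Nat.card (⟨0, 0, 0, -1, 0⟩ : WeierstrassCurve (ZMod 3)).toAffine.Point = 4 ∧
      Nat.card (⟨0, 0, 0, -1, 1⟩ : WeierstrassCurve (ZMod 3)).toAffine.Point = 7 ∧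
        Nat.card (⟨0, 0, 0, -1, 2⟩ : WeierstrassCurve (ZMod 3)).toAffine.Point = 1 := by
  have h0 := natCard_point_specialFibre 0
  have h1 := natCard_point_specialFibre 1
  have h2 := natCard_point_specialFibre 2
  obtain ⟨v0, v1, v2⟩ := valMinAbs_three_values
  rw [v0] at h0
  rw [v1] at h1
  rw [v2] at h2
  refine ⟨?_, ?_, ?_⟩ <;> omega

/-- `a = 0 ⟺ b̄ = 0` (the special fibre is `y² = x³ − x`, full rational `2`-torsion, `#Ē(𝔽₃) = 4`) — the
`a_w = 0` third of the principal-series rows (`133` of the `416` K1/K2 classes with `N < 5·10⁵`; there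
`ℚ₃(E[2]) = ℚ₃(ζ₉)⁺` and `α² = −3` for the untwisted eigenvalue, memo LAW-La3 §8). [cite: Kraus1990, Théorème (p = 3)] -/
theorem trace_specialFibre_eq_zero_iff (b : ZMod 3) :
    (3 : ℤ) + 1 - Nat.card (⟨0, 0, 0, -1, b⟩ : WeierstrassCurve (ZMod 3)).toAffine.Point = 0 ↔ b = 0 := by
  rw [trace_specialFibre]
  obtain ⟨v0, v1, v2⟩ := valMinAbs_three_values
  rcases zmod_three_cases b with rfl | rfl | rfl
  · rw [v0]; simp
  · rw [v1]; simp
  · rw [v2]; decide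

/-- `3 ∣ a` and `|a| ≤ 3` for all three special fibres (supersingular, `j = 0`; the Hasse bound `|a| ≤ 2√3` leaves
exactly `{0, ±3}`). [cite: SilvermanAEC2009, Ex. V.4.4] -/
theorem three_dvd_trace_specialFibre (b : ZMod 3) :
    (3 : ℤ) ∣ (3 : ℤ) + 1 - Nat.card (⟨0, 0, 0, -1, b⟩ : WeierstrassCurve (ZMod 3)).toAffine.Point ∧
      ((3 : ℤ) + 1 - Nat.card (⟨0, 0, 0, -1, b⟩ : WeierstrassCurve (ZMod 3)).toAffine.Point).natAbs ≤ 3 := by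
  rw [trace_specialFibre]
  obtain ⟨v0, v1, v2⟩ := valMinAbs_three_values
  rcases zmod_three_cases b with rfl | rfl | rfl
  · rw [v0]; decide
  · rw [v1]; decide
  · rw [v2]; decide

end Summit.BirchSwinnertonDyer.BirchSwinnertonDyer.Theorems.GNineSpecialFibrePointCount
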